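import Summits.BirchSwinnertonDyer.Rank1Residual.X10.MuTransferThreeOfFine
import HarnessLib

/-!
# Class X10 at `p = 3`, rank `1`, CLASS-FREE and EITHER image, modulo Kato's zeta-element package F1: the
# integral divisibility datum, the Euler-system half (modulo the Schneider certificate) and Miller's
# `BSD(E,3)` at the `3 ∤ #Ш_an` pairs, stated on `3` good ordinary + `E[3]` irreducible + analytic rank
# `1` ALONE (no `ClassX10`, no `¬ Surj` binder), plus the literal-model RECORD shape for rank-`1` cells
# (cell `b2b-bsdres`, unit `b2b-bsdres-x10` = N2 class lead, GEN 41; TOOL — theorems only, no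
# definition, no named fact, nothing booked)

HONEST FRAMING (run/shared/lean/b2b/bsd-rank1-residual/, verbatim in every file): the goal of the
cell is to DELETE the COMBINATION-SHAPED residual classes of the Birch–Swinnerton-Dyer formula for
ALL analytic-rank `≤ 1` elliptic curves over `ℚ` — "full BSD formula for every rank `≤ 1` curve in
class `C`" assembled STRICTLY from published theorems — so that the rank-`≤ 1` remainder becomes
exactly the CONSTRUCTION-SHAPED classes, which are TYPED (missing-input `Prop`s), NOT attempted.
This is not "finishing BSD".  Class X10b (= N2) keeps its label CONSTRUCTION-SHAPED / NEEDS X_A3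
(RESIDUAL-MAP §I N2).  Nothing is booked by this file; no census word and no mark moves; everything
below is PER PAIR.  PARTITION (D-0054): X10b∧¬Surj (A5) × p = 3 at rank `1` (and X10a′ ∩ {r = 1}) —
types-the-object-of; closes NONE.

## What (x10 GEN 41, X10-AUDIT §47; companion of `X10/MuTransferThreeOfFine[BothRanks].lean`)

GEN 36 gave the rank-`0` per-pair statements a CLASS-FREE, image-free form (`3` good ordinary, `E[3]`
irreducible, `L(E,1) ≠ 0`: `bsdp_three_of_katoMuTransferThree_of_shaAn_unit`, now
`bsdp_three_of_fine_of_shaAn_unit`) and a literal-model RECORD shape, so that a rank-`0` cell is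
recorded from `[a1,a2,a3,a4,a6]`, `decide`-able certificates and census binders with NO image
certificate.  The rank-`1` statements (GEN 35, `…RankOneAnyImage`; GEN 41 `…_of_fine[_anyImage]`) still
carried `hX : ClassX10 W 3`, whose rank-`1` clause asks for `¬ Semistable W` — true on every N2 row
(`E[3]` irreducible and `ρ̄` not onto force an additive prime) but a per-cell Tate-algorithm proof in the
kernel.  The rank-one engine (`Theorems.Rank1ResidualX10bMainConjecture.X10.missingUpperBoundAt_three_rankOne_of_divisibility`,
x10 GEN 6) uses `hX` ONLY through `GoodOrd W 3`.  THIS FILE restates the rank-`1` chain class-free: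

* `divisibility_three_of_fine_classFree` — EITHER image, any rank: F1 ∧ one unit coefficient of
  `L_3(f, α)` ⟹ the Néron-normalised integral divisibility datum (surjective `ρ̄_{E,3}`: the
  good-ordinary tower `surjective_pow_of_goodOrd_of_surj` + Kato (3), certificate idle; otherwise Kato (2)
  + the transfer's `μ = 0`, `mu_eq_zero_three_of_fine`);
* `missingUpperBoundAt_three_rankOne_of_divisibility_classFree` — the GEN 6 engine re-run on
  `(hgood, hord)` with the Mazur–Tate `σ` DISCHARGED (`mazur_tate_sigma_exists_odd_holds`): divisibility
  datum ∧ Schneider certificate ⟹ `ord₃ #Ш(E/ℚ) ≤ ord₃ #Ш(E/ℚ)_an`;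
* `missingUpperBoundAt_three_rankOne_of_fine_classFree`, **`bsdp_three_rankOne_of_fine_of_shaAn_unit_classFree`**
  (F1 ∧ certificates ⟹ Miller's `BSD(E,3)` at a rank-`1` pair with `3 ∤ #Ш_an`), and the both-ranks
  class-free form **`bsdp_three_of_fine_of_shaAn_unit_of_analyticRank_le_one`**;
* `MuZeroRoad.bsdp_three_rankOne_of_ainvs_of_fine_of_shaAn_unit` and
  `MuZeroRoad.bsdp_three_of_ainvs_of_fine_of_shaAn_unit_of_analyticRank_le_one` — the RECORD shapes:
  with GEN 41's rank-`0` shape every one of the 292 N2 cells with `3 ∤ #Ш_an` (253 of rank `0`, 39 of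
  rank `1`) is recordable from its minimal model, the `decide`d certificates (`3 ∤ Δ`, point count at `3`,
  a Frobenius witness `ℓ`) and the census binders `hL` / `hr1`, `hcertA` (MUCERT3 313/313, three engines),
  `hunit`, `hSch` (39/39, two engines) — no image certificate, no `ClassX10` proof, no flag.

Binders of every theorem: F1 (`hfine`); PUBLISHED `Schneider1985_order_charGenerator_odd` (`hS`),
`perrinRiou_rankOne_leadingTerms_odd` (`hPR`), `nonempty_modularParametrizationData` (`hmodP`),
`rank_eq_analyticRank_of_analyticRank_le_one` (`hGZK`), `realPeriodRat_eq_unit_mul_plusPeriod_three`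
(`h3`); certificates / census data as displayed.  No Kato 17.4 / 12.4 binder, no `σ`-fact, no rational main
conjecture, no image hypothesis.

References: K. Kato, Astérisque 295 (2004) Thm. 12.6, Thm. 17.4 (2), (3) (p. 273), §17.13
[Kato2004Asterisque]; B. Perrin-Riou, Bull. SMF 115 (1987) §1.4 Cor. 1.8 [PerrinRiou1987]; J.
Balakrishnan, J. S. Müller, W. Stein, Math. Comp. 85 (2016) Thm. 1.7 [BalakrishnanMullerStein2015]; C.
Wuthrich, Doc. Math. 19 (2014) Lemma 20 [Wuthrich2014]; R. Greenberg, V. Vatsal, Invent. Math. 142 (2000)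
Prop. 3.7, Rem. 3.4 [GreenbergVatsal2000]; B. Mazur, Invent. Math. 44 (1978) Prop. 6.3 (1) [Mazur1978];
R. L. Miller, LMS J. Comput. Math. 14 (2011) Def. 1.1 [Miller2011LMS]; X10-AUDIT §12, §41, §47.
-/

set_option autoImplicit false

noncomputable section

open scoped Classical MatrixGroups ModularForm

open CongruenceSubgroup WeierstrassCurve Field Literature.NumberTheory.GaloisRepresentations
  Literature.NumberTheory.GaloisCohomology Literature.NumberTheory.EllipticCurves
  Literature.NumberTheory.EllipticCurves.ModularForms Literature.NumberTheory.EllipticCurves.Rank1Residual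
  Literature.NumberTheory.EllipticCurves.Rank1Residual.Typed
  Literature.NumberTheory.EllipticCurves.Wuthrich2014
  Literature.NumberTheory.EllipticCurves.Kato2004 Literature.NumberTheory.EllipticCurves.Kato2004.EulerSystemValues
  Literature.NumberTheory.EllipticCurves.Rank1Residual.X11RankOneCertificates
  Summit.BirchSwinnertonDyer.BirchSwinnertonDyer.Rank1Residual.IntModel
  Summit.BirchSwinnertonDyer.BirchSwinnertonDyer.Rank1Residual.X11RankOne
  Summit.BirchSwinnertonDyer.BirchSwinnertonDyer.Theorems.Rank1ResidualX1Defs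
  Summit.BirchSwinnertonDyer.BirchSwinnertonDyer.Rank1Residual

namespace Summit.BirchSwinnertonDyer.Rank1Residual.X10

section ClassFree

variable (W : WeierstrassCurve ℚ) [W.IsElliptic] [W.IsGloballyMinimal]

/-- **`3` good ordinary, `E[3]` irreducible, EITHER mod-`3` image, any rank: F1 ∧ one unit coefficient of
`L_3(f, α)` ⟹ the Néron-normalised INTEGRAL divisibility datum at `(E,3)`** — for every cyclotomic
`(κ, γ)`, the newform `f` of level `N_E`, the period ratio `ϖ` (`ϖ · Ω_E = Ω⁺_f`) and every dual datum `D`: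
`X` is `Λ`-torsion and some `g ∈ char_Λ X` has `ι g = ϖ · L_3(f, α)`.  Surjective `ρ̄_{E,3}`: the
good-ordinary tower (`surjective_pow_of_goodOrd_of_surj`, Wuthrich's Lemma 20 as a tree theorem) + Kato
(3) (`divisibility_of_kato_of_surjective_pow`; the certificate is idle); otherwise Kato (2) + the
transfer's `μ = 0` (`mu_eq_zero_three_of_fine`, `divisibility_of_kato_of_mu_eq_zero`).  Kato's Thm. 17.4
at the pair is `kato_divisibility_three_of_fine`; `ϖ ≠ 0` as `Ω⁺_f > 0`; `ord₃ ϖ = 0` from `h3`.  CLASS-FREE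
form of GEN 35's `divisibility_three_of_katoMuTransferThree_anyImage`.
[cite: Kato2004Asterisque, Thm. 17.4 (2), (3) (p. 273) and §17.13 (pp. 279–280)] [cite: Wuthrich2014, Lemma 20 (p. 399)]
[cite: GreenbergVatsal2000, p. 2 (1)–(2), Prop. (3.7) and §3 Remark (3.4)] -/
theorem divisibility_three_of_fine_classFree (hfine : exists_divisibilityInputs_fineQuotient_zeta)
    (hmodP : nonempty_modularParametrizationData) (h3 : realPeriodRat_eq_unit_mul_plusPeriod_three)
    (hgood : W.HasGoodReductionAtPrime 3) (hord : ¬ ((3 : ℕ) : ℤ) ∣ W.frobeniusTrace 3)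
    (hirr : W.HasIrreducibleModPGaloisRep 3)
    (hcertA : ∀ {N : ℕ} [NeZero N] (f : CuspForm (Gamma0 N) 2), IsNewformOf W f →
      ∃ n : ℕ, ‖PowerSeries.coeff n (padicLFunction f (unitRoot W 3 : ℚ_[3]))‖ = 1) :
    ∀ (κ : ZpExtension ℚ 3) (γ : Field.absoluteGaloisGroup ℚ),
        κ.IsCyclotomic → κ.IsTopGenerator γ → IsCyclotomicVariable 3 γ →
      ∀ [NeZero (W.conductorNorm ℤ)] (f : CuspForm (Gamma0 (W.conductorNorm ℤ)) 2),
        IsNewformOf W f → ∀ (ϖ : ℚ), (ϖ : ℝ) * W.realPeriodRat = plusPeriod f →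
      ∀ (D : W.SelmerDualData κ γ), D.IsTorsion ∧
        ∃ g ∈ D.charIdeal, iwasawaToPowerSeries 3 g =
          PowerSeries.C (ϖ : ℚ_[3]) * padicLFunction f (unitRoot W 3 : ℚ_[3]) := by
  intro κ γ hκ hγ hγ' _ f hf ϖ hϖeq D
  have hplus : plusPeriod f ≠ 0 := (IsNewform0.plusPeriod_pos_holds hf.1 hf.coeffField_eq_bot).ne'
  have hϖ0 : ϖ ≠ 0 := by
    rintro rfl
    apply hplus
    rw [← hϖeq]
    simp
  have hϖv : padicValRat 3 ϖ = 0 := padicValRat_periodRatio_eq_zero_three W h3 hgood hirr f hf ϖ hϖeq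
  by_cases hsurj : Surj W 3
  · exact divisibility_of_kato_of_surjective_pow W 3 (kato_divisibility_three_of_fine hfine W κ γ f)
      (by decide) hgood hord (surjective_pow_of_goodOrd_of_surj W (by decide) ⟨hgood, hord⟩ hsurj) hκ hγ
      hγ' hf D ϖ hϖ0 hϖv
  · exact divisibility_of_kato_of_mu_eq_zero W 3 (kato_divisibility_three_of_fine hfine W κ γ f)
      (by decide) hgood hord hirr hκ hγ hγ' hf D
      (mu_eq_zero_three_of_fine W hfine hmodP hgood hord hirr hsurj hcertA κ γ hκ hγ hγ' D) ϖ hϖ0 hϖv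

/-- **`3` good ordinary, analytic rank `1`, EITHER image: an integral Kato-direction divisibility datum at
`(E,3)` ∧ the Schneider certificate ⟹ the Euler-system half `ord₃ #Ш(E/ℚ) ≤ ord₃ #Ш(E/ℚ)_an`** — x10
GEN 6's engine `X10.missingUpperBoundAt_three_rankOne_of_divisibility` re-run CLASS-FREE (it used
`ClassX10 W 3` only through `GoodOrd W 3`) and with the Mazur–Tate `σ` discharged
(`mazur_tate_sigma_exists_odd_holds`, so THE canonical `3`-adic height datum exists).  The defect is
`ord₃ h(0) ≥ 0` for the cofactor `h` of unit x1b's engine `exists_cofactor_of_mem_charIdeal_of_rank_one_odd`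
(Perrin-Riou–Schneider `hS`, Perrin-Riou 1987 `hPR`, GZK `hGZK`; the newform and `ϖ` from `hmodP`).
[cite: PerrinRiou1987, §1.4 Cor. 1.8] [cite: BalakrishnanMullerStein2015, Thm. 1.7]
[cite: MazurSteinTate2006, §1 eq. (1.1)] [cite: Miller2011LMS, Def. 1.1 (arXiv:1010.2431 p. 3)] -/
theorem missingUpperBoundAt_three_rankOne_of_divisibility_classFree
    (hS : Schneider1985_order_charGenerator_odd) (hPR : perrinRiou_rankOne_leadingTerms_odd)
    (hmodP : nonempty_modularParametrizationData)
    (hGZK : rank_eq_analyticRank_of_analyticRank_le_one)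
    (hgood : W.HasGoodReductionAtPrime 3) (hord : ¬ ((3 : ℕ) : ℤ) ∣ W.frobeniusTrace 3)
    (hr1 : W.analyticRank = 1)
    (hSch : ∀ Dh : PAdicHeightData W 3, Dh.IsCanonical → SchneiderConjecture Dh)
    (hdiv : ∀ (κ : ZpExtension ℚ 3) (γ : Field.absoluteGaloisGroup ℚ),
        κ.IsCyclotomic → κ.IsTopGenerator γ → IsCyclotomicVariable 3 γ →
      ∀ [NeZero (W.conductorNorm ℤ)] (f : CuspForm (Gamma0 (W.conductorNorm ℤ)) 2),
        IsNewformOf W f → ∀ (ϖ : ℚ), (ϖ : ℝ) * W.realPeriodRat = plusPeriod f →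
      ∀ (D : W.SelmerDualData κ γ), D.IsTorsion ∧
        ∃ g ∈ D.charIdeal, iwasawaToPowerSeries 3 g =
          PowerSeries.C (ϖ : ℚ_[3]) * padicLFunction f (unitRoot W 3 : ℚ_[3])) :
    Typed.MissingUpperBoundAt W 3 := by
  obtain ⟨κ, hκ, γ, hγ, hγ'⟩ := exists_isCyclotomic_isTopGenerator_isCyclotomicVariable_holds 3
  obtain ⟨D⟩ := W.nonempty_selmerDualData_holds κ γ hγ
  haveI : NeZero (W.conductorNorm ℤ) := ⟨(W.conductorNorm_pos_holds).ne'⟩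
  obtain ⟨Dm⟩ := hmodP W
  obtain ⟨ϖ, -, hϖ, -⟩ := Dm.exists_rat_mul_realPeriodRat_eq_plusPeriod
  obtain ⟨Dh, hDh, -⟩ :=
    existsUnique_isCanonical_of_odd mazur_tate_sigma_exists_odd_holds W 3 (by decide) hgood hord
  obtain ⟨hXt, g, hgmem, hιg⟩ := hdiv κ γ hκ hγ hγ' Dm.f Dm.isNewformOf ϖ hϖ D
  obtain ⟨fE, h, s, -, -, -, -, hsha, -, hval⟩ := exists_cofactor_of_mem_charIdeal_of_rank_one_odd
    hS hPR hGZK W 3 (by decide) hgood hord hr1 hκ hγ hγ' Dm.isNewformOf ϖ hϖ Dh hDh (hSch Dh hDh) D hXt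
    g hgmem hιg
  refine ⟨s, hsha, ?_⟩
  have h0 : 0 ≤ (((PowerSeries.constantCoeff h : ℤ_[3]) : ℚ_[3])).valuation :=
    PadicInt.valuation_coe_nonneg
  rw [hval]
  linarith

/-- **`3` good ordinary, `E[3]` irreducible, analytic rank `1`, EITHER image: F1 ∧ the unit-coefficient
certificate ⟹ the Euler-system half `ord₃ #Ш(E/ℚ) ≤ ord₃ #Ш(E/ℚ)_an`, modulo the Schneider certificate**
— `divisibility_three_of_fine_classFree` into the class-free engine.  CLASS-FREE form of
`missingUpperBoundAt_three_rankOne_of_fine_anyImage`.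
[cite: Kato2004Asterisque, Thm. 17.4 (2), (3) (p. 273) and §17.13 (pp. 279–280)] [cite: PerrinRiou1987, §1.4 Cor. 1.8]
[cite: BalakrishnanMullerStein2015, Thm. 1.7] -/
theorem missingUpperBoundAt_three_rankOne_of_fine_classFree
    (hfine : exists_divisibilityInputs_fineQuotient_zeta)
    (hS : Schneider1985_order_charGenerator_odd) (hPR : perrinRiou_rankOne_leadingTerms_odd)
    (hmodP : nonempty_modularParametrizationData)
    (hGZK : rank_eq_analyticRank_of_analyticRank_le_one)
    (h3 : realPeriodRat_eq_unit_mul_plusPeriod_three)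
    (hgood : W.HasGoodReductionAtPrime 3) (hord : ¬ ((3 : ℕ) : ℤ) ∣ W.frobeniusTrace 3)
    (hirr : W.HasIrreducibleModPGaloisRep 3) (hr1 : W.analyticRank = 1)
    (hSch : ∀ Dh : PAdicHeightData W 3, Dh.IsCanonical → SchneiderConjecture Dh)
    (hcertA : ∀ {N : ℕ} [NeZero N] (f : CuspForm (Gamma0 N) 2), IsNewformOf W f →
      ∃ n : ℕ, ‖PowerSeries.coeff n (padicLFunction f (unitRoot W 3 : ℚ_[3]))‖ = 1) :
    Typed.MissingUpperBoundAt W 3 :=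
  missingUpperBoundAt_three_rankOne_of_divisibility_classFree W hS hPR hmodP hGZK hgood hord hr1 hSch
    (divisibility_three_of_fine_classFree W hfine hmodP h3 hgood hord hirr hcertA)

/-- **`3` good ordinary, `E[3]` irreducible, analytic rank `1`, EITHER image, at a pair with
`ord₃ #Ш(E/ℚ)_an = 0`: F1 ∧ the finite certificates ⟹ Miller's `BSD(E,3)`** — the lower half is vacuous
(`hunit`), the upper half is `missingUpperBoundAt_three_rankOne_of_fine_classFree`; GZK assembles.  Binders:
F1; PUBLISHED `hS`, `hPR`, `hmodP`, `hGZK`, `h3`; certificates `hcertA` (unit coefficient of `L_3(f, α)`),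
`hSch` (THE canonical cyclotomic `3`-adic height is non-degenerate), `hunit` (`3 ∤ #Ш_an`); census `hr1`.
CLASS-FREE form of `bsdp_three_rankOne_of_fine_of_shaAn_unit[_anyImage]` — no `ClassX10`, no `¬ Surj`.
Per pair; nothing booked. [cite: Kato2004Asterisque, Thm. 12.6 (p. 222), Thm. 17.4 (2), (3) (p. 273) and §17.13 (pp. 279–280)]
[cite: PerrinRiou1987, §1.4 Cor. 1.8] [cite: BalakrishnanMullerStein2015, Thm. 1.7] [cite: Miller2011LMS, Def. 1.1 (arXiv:1010.2431 p. 3)] -/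
theorem bsdp_three_rankOne_of_fine_of_shaAn_unit_classFree
    (hfine : exists_divisibilityInputs_fineQuotient_zeta)
    (hS : Schneider1985_order_charGenerator_odd) (hPR : perrinRiou_rankOne_leadingTerms_odd)
    (hmodP : nonempty_modularParametrizationData)
    (hGZK : rank_eq_analyticRank_of_analyticRank_le_one)
    (h3 : realPeriodRat_eq_unit_mul_plusPeriod_three)
    (hgood : W.HasGoodReductionAtPrime 3) (hord : ¬ ((3 : ℕ) : ℤ) ∣ W.frobeniusTrace 3)
    (hirr : W.HasIrreducibleModPGaloisRep 3) (hr1 : W.analyticRank = 1)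
    (hSch : ∀ Dh : PAdicHeightData W 3, Dh.IsCanonical → SchneiderConjecture Dh)
    (hcertA : ∀ {N : ℕ} [NeZero N] (f : CuspForm (Gamma0 N) 2), IsNewformOf W f →
      ∃ n : ℕ, ‖PowerSeries.coeff n (padicLFunction f (unitRoot W 3 : ℚ_[3]))‖ = 1)
    (hunit : ∃ q : ℚ, shaAn W = (q : ℂ) ∧ padicValRat 3 q = 0) : BSDp W 3 := by
  refine bsdp_of_missingPPartAt W 3 hGZK hr1.le (missingPPartAt_of_lower_of_upper W 3 ?_
    (missingUpperBoundAt_three_rankOne_of_fine_classFree W hfine hS hPR hmodP hGZK h3 hgood hord hirr hr1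
      hSch hcertA))
  obtain ⟨q, hq, hv⟩ := hunit
  exact ⟨q, hq, by rw [hv]; exact_mod_cast Nat.zero_le _⟩

/-- **`3` good ordinary, `E[3]` irreducible, analytic rank `≤ 1`, EITHER image, at a pair with
`ord₃ #Ш(E/ℚ)_an = 0`: F1 ∧ the finite certificates ⟹ Miller's `BSD(E,3)`** — the class-free per-pair
statement of N2 (and X10a′) in BOTH ranks: analytic rank `0` is GEN 41's `bsdp_three_of_fine_of_shaAn_unit`
(`L(E,1) ≠ 0` from `analyticRank_eq_zero_iff_holds`; the Schneider certificate is not used), analytic rank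
`1` is `bsdp_three_rankOne_of_fine_of_shaAn_unit_classFree`.  Binders: F1; PUBLISHED `hS`, `hPR`, `hmodP`,
`hGZK`, `h3`; certificates `hcertA`, `hunit`, `hSch` (at `r = 1`); census `hr`.  Nothing booked.
[cite: Kato2004Asterisque, Thm. 12.6 (p. 222), Thm. 17.4 (2), (3) (p. 273) and §17.13 (pp. 279–280)]
[cite: PerrinRiou1987, §1.4 Cor. 1.8] [cite: GreenbergLNM1716, §1 Conj. 1.11 and Thm. 4.1 (p. 102)]
[cite: Miller2011LMS, Def. 1.1 (arXiv:1010.2431 p. 3)] -/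
theorem bsdp_three_of_fine_of_shaAn_unit_of_analyticRank_le_one
    (hfine : exists_divisibilityInputs_fineQuotient_zeta)
    (hS : Schneider1985_order_charGenerator_odd) (hPR : perrinRiou_rankOne_leadingTerms_odd)
    (hmodP : nonempty_modularParametrizationData)
    (hGZK : rank_eq_analyticRank_of_analyticRank_le_one)
    (h3 : realPeriodRat_eq_unit_mul_plusPeriod_three)
    (hgood : W.HasGoodReductionAtPrime 3) (hord : ¬ ((3 : ℕ) : ℤ) ∣ W.frobeniusTrace 3)
    (hirr : W.HasIrreducibleModPGaloisRep 3) (hr : W.analyticRank ≤ 1)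
    (hSch : W.analyticRank = 1 → ∀ Dh : PAdicHeightData W 3, Dh.IsCanonical → SchneiderConjecture Dh)
    (hcertA : ∀ {N : ℕ} [NeZero N] (f : CuspForm (Gamma0 N) 2), IsNewformOf W f →
      ∃ n : ℕ, ‖PowerSeries.coeff n (padicLFunction f (unitRoot W 3 : ℚ_[3]))‖ = 1)
    (hunit : ∃ q : ℚ, shaAn W = (q : ℂ) ∧ padicValRat 3 q = 0) : BSDp W 3 := by
  rcases Nat.lt_or_eq_of_le hr with hlt | hr1
  · have hr0 : W.analyticRank = 0 := by omega
    haveI : NeZero (W.conductorNorm ℤ) := ⟨(W.conductorNorm_pos_holds).ne'⟩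
    obtain ⟨Dm⟩ := hmodP W
    have hL : W.entireLFunction 1 ≠ 0 :=
      (W.analyticRank_eq_zero_iff_holds Dm.isNewformOf.hasEntireLFunction).mp hr0
    exact bsdp_three_of_fine_of_shaAn_unit W hfine hS hmodP hGZK h3 hgood hord hirr hL hcertA hunit
  · exact bsdp_three_rankOne_of_fine_of_shaAn_unit_classFree W hfine hS hPR hmodP hGZK h3 hgood hord hirr
      hr1 (hSch hr1) hcertA hunit

end ClassFree

/-! ### The same read off a literal integer model — the rank-`1` and both-ranks RECORD shapes -/

namespace MuZeroRoad

/-- **F1 ∧ certificates ∧ `ord₃ #Ш(E/ℚ)_an = 0` ⟹ Miller's `BSD(E,3)` at an analytic-rank-`1` cell given by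
a literal integer model** `[a1,a2,a3,a4,a6]` (`integralModelInt W`): good ordinary `3` and `E[3]`
irreducible are READ OFF the model (`3 ∤ Δ`; the point count `n3` at `3` with `3 ∤ 4 − n3`; one good prime
`ℓ ∤ 6Δ` whose Frobenius polynomial has no root mod `3` — GEN 34's
`goodOrdIrr_three_of_ainvs_of_countPoints`), EITHER image, NO `ClassX10` / `¬ Surj` proof; then
`bsdp_three_rankOne_of_fine_of_shaAn_unit_classFree`.  Census binders per cell: `hr1` (analytic rank `1`),
`hcertA` (unit coefficient; MUCERT3), `hSch` (Schneider certificate; 39/39 N2 rank-`1` cells on record,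
two engines), `hunit` (`3 ∤ #Ш_an`).  Per pair; nothing booked.
[cite: Kato2004Asterisque, Thm. 17.4 (2), (3) (p. 273) and §17.13 (pp. 279–280)] [cite: Mazur1978, §6 Prop. 6.3 (1) (p. 153)]
[cite: PerrinRiou1987, §1.4 Cor. 1.8] [cite: Miller2011LMS, Def. 1.1 (arXiv:1010.2431 p. 3)] -/
theorem bsdp_three_rankOne_of_ainvs_of_fine_of_shaAn_unit
    (hfine : exists_divisibilityInputs_fineQuotient_zeta)
    (hS : Schneider1985_order_charGenerator_odd) (hPR : perrinRiou_rankOne_leadingTerms_odd)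
    (hmodP : nonempty_modularParametrizationData)
    (hGZK : rank_eq_analyticRank_of_analyticRank_le_one)
    (h3 : realPeriodRat_eq_unit_mul_plusPeriod_three)
    (a1 a2 a3 a4 a6 : ℤ) {W : WeierstrassCurve ℚ} [W.IsElliptic] [W.IsGloballyMinimal]
    (hW : integralModelInt W = ⟨a1, a2, a3, a4, a6⟩)
    (ℓ n n3 : ℕ) [Fact ℓ.Prime]
    (h3Δ : ¬ (3 : ℤ) ∣ discOf [a1, a2, a3, a4, a6])
    (hc3 : countPoints [a1, a2, a3, a4, a6] 3 = n3) (hord3 : ¬ (3 : ℤ) ∣ (3 : ℤ) + 1 - n3)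
    (hℓ2 : ℓ ≠ 2) (hℓ3 : ℓ ≠ 3) (hℓΔ : ¬ (ℓ : ℤ) ∣ discOf [a1, a2, a3, a4, a6])
    (hc : countPoints [a1, a2, a3, a4, a6] ℓ = n)
    (hnoroot : ∀ t : ℕ, t < 3 → ¬ (3 : ℤ) ∣ (t : ℤ) ^ 2 - ((ℓ : ℤ) + 1 - n) * t + ℓ)
    (hr1 : W.analyticRank = 1)
    (hSch : ∀ Dh : PAdicHeightData W 3, Dh.IsCanonical → SchneiderConjecture Dh)
    (hcertA : ∀ {N : ℕ} [NeZero N] (f : CuspForm (Gamma0 N) 2), IsNewformOf W f →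
      ∃ n : ℕ, ‖PowerSeries.coeff n (padicLFunction f (unitRoot W 3 : ℚ_[3]))‖ = 1)
    (hunit : ∃ q : ℚ, shaAn W = (q : ℂ) ∧ padicValRat 3 q = 0) : BSDp W 3 := by
  obtain ⟨hgood, hord, hirr⟩ := goodOrdIrr_three_of_ainvs_of_countPoints a1 a2 a3 a4 a6 hW ℓ n n3 h3Δ
    hc3 hord3 hℓ2 hℓ3 hℓΔ hc hnoroot
  exact bsdp_three_rankOne_of_fine_of_shaAn_unit_classFree W hfine hS hPR hmodP hGZK h3 hgood hord hirr
    hr1 hSch hcertA hunit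

/-- **F1 ∧ certificates ∧ `ord₃ #Ш(E/ℚ)_an = 0` ⟹ Miller's `BSD(E,3)` at a cell of analytic rank `≤ 1`
given by a literal integer model** — the both-ranks RECORD shape (`hr : W.analyticRank ≤ 1`, `hSch` used
only at rank `1`); with it every one of the 292 N2 cells with `3 ∤ #Ш_an` is recordable from the model, the
`decide`d certificates and census binders alone.  Per pair; nothing booked.
[cite: Kato2004Asterisque, Thm. 17.4 (2), (3) (p. 273) and §17.13 (pp. 279–280)] [cite: Mazur1978, §6 Prop. 6.3 (1) (p. 153)]
[cite: PerrinRiou1987, §1.4 Cor. 1.8] [cite: GreenbergLNM1716, §1 Conj. 1.11 and Thm. 4.1 (p. 102)]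
[cite: Miller2011LMS, Def. 1.1 (arXiv:1010.2431 p. 3)] -/
theorem bsdp_three_of_ainvs_of_fine_of_shaAn_unit_of_analyticRank_le_one
    (hfine : exists_divisibilityInputs_fineQuotient_zeta)
    (hS : Schneider1985_order_charGenerator_odd) (hPR : perrinRiou_rankOne_leadingTerms_odd)
    (hmodP : nonempty_modularParametrizationData)
    (hGZK : rank_eq_analyticRank_of_analyticRank_le_one)
    (h3 : realPeriodRat_eq_unit_mul_plusPeriod_three)
    (a1 a2 a3 a4 a6 : ℤ) {W : WeierstrassCurve ℚ} [W.IsElliptic] [W.IsGloballyMinimal]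
    (hW : integralModelInt W = ⟨a1, a2, a3, a4, a6⟩)
    (ℓ n n3 : ℕ) [Fact ℓ.Prime]
    (h3Δ : ¬ (3 : ℤ) ∣ discOf [a1, a2, a3, a4, a6])
    (hc3 : countPoints [a1, a2, a3, a4, a6] 3 = n3) (hord3 : ¬ (3 : ℤ) ∣ (3 : ℤ) + 1 - n3)
    (hℓ2 : ℓ ≠ 2) (hℓ3 : ℓ ≠ 3) (hℓΔ : ¬ (ℓ : ℤ) ∣ discOf [a1, a2, a3, a4, a6])
    (hc : countPoints [a1, a2, a3, a4, a6] ℓ = n)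
    (hnoroot : ∀ t : ℕ, t < 3 → ¬ (3 : ℤ) ∣ (t : ℤ) ^ 2 - ((ℓ : ℤ) + 1 - n) * t + ℓ)
    (hr : W.analyticRank ≤ 1)
    (hSch : W.analyticRank = 1 → ∀ Dh : PAdicHeightData W 3, Dh.IsCanonical → SchneiderConjecture Dh)
    (hcertA : ∀ {N : ℕ} [NeZero N] (f : CuspForm (Gamma0 N) 2), IsNewformOf W f →
      ∃ n : ℕ, ‖PowerSeries.coeff n (padicLFunction f (unitRoot W 3 : ℚ_[3]))‖ = 1)
    (hunit : ∃ q : ℚ, shaAn W = (q : ℂ) ∧ padicValRat 3 q = 0) : BSDp W 3 := by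
  obtain ⟨hgood, hord, hirr⟩ := goodOrdIrr_three_of_ainvs_of_countPoints a1 a2 a3 a4 a6 hW ℓ n n3 h3Δ
    hc3 hord3 hℓ2 hℓ3 hℓΔ hc hnoroot
  exact bsdp_three_of_fine_of_shaAn_unit_of_analyticRank_le_one W hfine hS hPR hmodP hGZK h3 hgood hord
    hirr hr hSch hcertA hunit

end MuZeroRoad

end Summit.BirchSwinnertonDyer.Rank1Residual.X10

end
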